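import Mathlib.Analysis.InnerProductSpace.PiL2
import Mathlib.Algebra.Order.Floor.Defs
import Mathlib.Tactic
import HarnessLib

/-!
# The upper-neighbour lemma for the checkerboard lattice `D₃` (cubic frame of fcc)

HONEST FRAMING. Part of the venture `Summits/Ventures/Crystal3D` (cell `crystal3d-full`), helper
`--supports` the crux `GenericWallFloor` (stmt-Ventures-19480, route
`route-Ventures-StickyWulffConstant`, line `WallLedgerG`, stub `stub_twoSlabAdhesion`).  This file
is the pure real-arithmetic core of the SEALING lemma for clamped slab samples (file
`…GenericWallFloorSealing`): in the cubic frame of `…NoReconstructionGainCubicFrame` the model fcc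
lattice is `D₃ = {(a,b,c) ∈ ℤ³ : a+b+c even}` with nearest-neighbour distance `√2`, and we prove

* `D3_exists_near_ge` — **upper-neighbour lemma**: for every point `X ∈ ℝ³ \ D₃` and every linear
  functional `λ` there is a lattice point `V ∈ D₃` with `|X − V|² < 2` (i.e. at fcc-distance `< 1`)
  and `λ(V) ≥ λ(X)`.  Equivalently: every non-lattice point lies in the convex hull of the lattice
  points at distance `< √2` from it.

Proof (Delaunay cells of `D₃` = the tetrahedral–octahedral honeycomb): reduce by the symmetries
`X ↦ X + n` (`n ∈ D₃`) and `x ↦ −x` to the unit cube `[0,1]³` with even corners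
`000, 110, 101, 011`; the cube is the regular tetrahedron on these corners plus four octants of the
octahedra centred at the odd corners `100, 010, 001, 111`.  In the tetrahedron every corner is at
distance `< √2` from every non-corner point and `X` is a convex combination of the corners
(`tetra_exists_near_ge`).  In an octant with centre `c`, `X = c + Σ ±tₖ eₖ`, `tₖ ≥ 0`, `Σ tₖ ≤ 1`,
`Σ tₖ² < 1`: the three vertices `c ± eₖ` on the side of `X` are always near, the opposite vertex
`c ∓ eₖ` is near iff `2 tₖ < 1 − Σ tⱼ²`, and `octant_core` shows one of these six carries
`λ ≥ λ(X)` (if all three near-side increments are `< L := λ(X) − λ(c)` then `Σ tₖ < 1`, `L ≤ 0`, and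
the smallest `tₖ` has a near opposite vertex with increment `> −L ≥ L`).

WHAT THIS IS NOT: nothing about packings or the crux's constants; rung F-C1 not moved.
-/

namespace Summit.Ventures.Crystal3D.Theorems

/-! ## Two arithmetic cores -/

/-- **Octant core.**  `t₁,t₂,t₃ ≥ 0`, `t₁+t₂+t₃ ≤ 1`, `S = t₁²+t₂²+t₃² < 1`, `g` arbitrary,
`L = Σ tₖ gₖ`.  Then some `k` has either (`S − 2tₖ < 1` and `gₖ ≥ L`) — the near-side vertex — or
(`S + 2tₖ < 1` and `−gₖ ≥ L`) — the opposite vertex, which is then at squared distance `< 2`. -/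
theorem octant_core (t₁ t₂ t₃ g₁ g₂ g₃ : ℝ) (h₁ : 0 ≤ t₁) (h₂ : 0 ≤ t₂) (h₃ : 0 ≤ t₃)
    (hσ : t₁ + t₂ + t₃ ≤ 1) (hS : t₁ ^ 2 + t₂ ^ 2 + t₃ ^ 2 < 1) :
    (t₁ ^ 2 + t₂ ^ 2 + t₃ ^ 2 - 2 * t₁ < 1 ∧ t₁ * g₁ + t₂ * g₂ + t₃ * g₃ ≤ g₁) ∨
    (t₁ ^ 2 + t₂ ^ 2 + t₃ ^ 2 - 2 * t₂ < 1 ∧ t₁ * g₁ + t₂ * g₂ + t₃ * g₃ ≤ g₂) ∨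
    (t₁ ^ 2 + t₂ ^ 2 + t₃ ^ 2 - 2 * t₃ < 1 ∧ t₁ * g₁ + t₂ * g₂ + t₃ * g₃ ≤ g₃) ∨
    (t₁ ^ 2 + t₂ ^ 2 + t₃ ^ 2 + 2 * t₁ < 1 ∧ t₁ * g₁ + t₂ * g₂ + t₃ * g₃ ≤ -g₁) ∨
    (t₁ ^ 2 + t₂ ^ 2 + t₃ ^ 2 + 2 * t₂ < 1 ∧ t₁ * g₁ + t₂ * g₂ + t₃ * g₃ ≤ -g₂) ∨
    (t₁ ^ 2 + t₂ ^ 2 + t₃ ^ 2 + 2 * t₃ < 1 ∧ t₁ * g₁ + t₂ * g₂ + t₃ * g₃ ≤ -g₃) := by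
  set L := t₁ * g₁ + t₂ * g₂ + t₃ * g₃ with hL
  set S := t₁ ^ 2 + t₂ ^ 2 + t₃ ^ 2 with hSdef
  by_contra h
  push Not at h
  obtain ⟨k₁, k₂, k₃, o₁, o₂, o₃⟩ := h
  -- the three near-side vertices are near, so their increments are `< L`
  have hg₁ : g₁ < L := k₁ (by nlinarith)
  have hg₂ : g₂ < L := k₂ (by nlinarith)
  have hg₃ : g₃ < L := k₃ (by nlinarith)
  -- `Σ tₖ (L − gₖ) = (σ − 1) L` with nonnegative terms
  have hid : t₁ * (L - g₁) + t₂ * (L - g₂) + t₃ * (L - g₃) = (t₁ + t₂ + t₃ - 1) * L := by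
    rw [hL]; ring
  have hp₁ : 0 ≤ t₁ * (L - g₁) := mul_nonneg h₁ (by linarith)
  have hp₂ : 0 ≤ t₂ * (L - g₂) := mul_nonneg h₂ (by linarith)
  have hp₃ : 0 ≤ t₃ * (L - g₃) := mul_nonneg h₃ (by linarith)
  -- `σ < 1`: if `σ = 1` every `tₖ (L − gₖ)` vanishes, so every `tₖ = 0`, so `σ = 0`
  have hσ' : t₁ + t₂ + t₃ < 1 := by
    rcases lt_or_eq_of_le hσ with h | h
    · exact h
    · exfalso
      have h0 : t₁ * (L - g₁) + t₂ * (L - g₂) + t₃ * (L - g₃) = 0 := by rw [hid, h]; ring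
      have e₁ : t₁ * (L - g₁) = 0 := by linarith
      have e₂ : t₂ * (L - g₂) = 0 := by linarith
      have e₃ : t₃ * (L - g₃) = 0 := by linarith
      have z₁ : t₁ = 0 := by rcases mul_eq_zero.1 e₁ with h' | h' <;> [exact h'; linarith]
      have z₂ : t₂ = 0 := by rcases mul_eq_zero.1 e₂ with h' | h' <;> [exact h'; linarith]
      have z₃ : t₃ = 0 := by rcases mul_eq_zero.1 e₃ with h' | h' <;> [exact h'; linarith]
      linarith
  -- hence `L ≤ 0`
  have hL0 : L ≤ 0 := by
    by_contra hL'
    push Not at hL'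
    have : (t₁ + t₂ + t₃ - 1) * L < 0 := mul_neg_of_neg_of_pos (by linarith) hL'
    linarith
  -- so every opposite vertex would do by its increment, hence none is near: `2 tₖ ≥ 1 − S`
  have q₁ : 1 ≤ S + 2 * t₁ := by
    by_contra hq; push Not at hq; have := o₁ hq; linarith
  have q₂ : 1 ≤ S + 2 * t₂ := by
    by_contra hq; push Not at hq; have := o₂ hq; linarith
  have q₃ : 1 ≤ S + 2 * t₃ := by
    by_contra hq; push Not at hq; have := o₃ hq; linarith
  -- contradiction: the smallest `tₖ` has `2 tₖ < 1 − S` when `σ < 1`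
  -- (if `t₁` is smallest: `S ≤ σ (σ − 2 t₁)` since `t₂ t₃ ≥ t₁²`, and
  -- `1 − σ(σ − 2t₁) − 2t₁ = (1 − σ)(1 + σ − 2 t₁) > 0`)
  rcases le_total t₁ t₂ with h12 | h21
  · rcases le_total t₁ t₃ with h13 | h31
    · -- t₁ smallest
      have hmin : t₁ ^ 2 ≤ t₂ * t₃ := by nlinarith
      nlinarith [mul_pos (show (0:ℝ) < 1 - (t₁ + t₂ + t₃) by linarith)
        (show (0:ℝ) < 1 + (t₁ + t₂ + t₃) - 2 * t₁ by linarith)]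
    · -- t₃ smallest
      have hmin : t₃ ^ 2 ≤ t₁ * t₂ := by nlinarith
      nlinarith [mul_pos (show (0:ℝ) < 1 - (t₁ + t₂ + t₃) by linarith)
        (show (0:ℝ) < 1 + (t₁ + t₂ + t₃) - 2 * t₃ by linarith)]
  · rcases le_total t₂ t₃ with h23 | h32
    · -- t₂ smallest
      have hmin : t₂ ^ 2 ≤ t₁ * t₃ := by nlinarith
      nlinarith [mul_pos (show (0:ℝ) < 1 - (t₁ + t₂ + t₃) by linarith)
        (show (0:ℝ) < 1 + (t₁ + t₂ + t₃) - 2 * t₂ by linarith)]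
    · -- t₃ smallest
      have hmin : t₃ ^ 2 ≤ t₁ * t₂ := by nlinarith
      nlinarith [mul_pos (show (0:ℝ) < 1 - (t₁ + t₂ + t₃) by linarith)
        (show (0:ℝ) < 1 + (t₁ + t₂ + t₃) - 2 * t₃ by linarith)]

/-- In an octant (`tₖ ≥ 0`, `Σ tₖ ≤ 1`) the squared norm is `< 1` unless `t` is a unit
coordinate vector: it suffices that no `tₖ` equals `1`. -/
theorem octant_sq_lt_one (t₁ t₂ t₃ : ℝ) (h₁ : 0 ≤ t₁) (h₂ : 0 ≤ t₂) (h₃ : 0 ≤ t₃)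
    (hσ : t₁ + t₂ + t₃ ≤ 1) (n₁ : t₁ ≠ 1) (n₂ : t₂ ≠ 1) (n₃ : t₃ ≠ 1) :
    t₁ ^ 2 + t₂ ^ 2 + t₃ ^ 2 < 1 := by
  have u₁ : t₁ ≤ 1 := by linarith
  have u₂ : t₂ ≤ 1 := by linarith
  have u₃ : t₃ ≤ 1 := by linarith
  have a₁ : 0 ≤ t₁ * (1 - t₁) := mul_nonneg h₁ (by linarith)
  have a₂ : 0 ≤ t₂ * (1 - t₂) := mul_nonneg h₂ (by linarith)
  have a₃ : 0 ≤ t₃ * (1 - t₃) := mul_nonneg h₃ (by linarith)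
  by_contra hS
  push Not at hS
  -- `S ≤ σ ≤ 1 ≤ S` forces every `tₖ (1 − tₖ) = 0`
  have e₁ : t₁ * (1 - t₁) = 0 := by nlinarith
  have e₂ : t₂ * (1 - t₂) = 0 := by nlinarith
  have e₃ : t₃ * (1 - t₃) = 0 := by nlinarith
  have z₁ : t₁ = 0 := by
    rcases mul_eq_zero.1 e₁ with h | h <;> [exact h; exact absurd (by linarith : t₁ = 1) n₁]
  have z₂ : t₂ = 0 := by
    rcases mul_eq_zero.1 e₂ with h | h <;> [exact h; exact absurd (by linarith : t₂ = 1) n₂]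
  have z₃ : t₃ = 0 := by
    rcases mul_eq_zero.1 e₃ with h | h <;> [exact h; exact absurd (by linarith : t₃ = 1) n₃]
  rw [z₁, z₂, z₃] at hS
  norm_num at hS

/-- **Tetrahedron nearness.**  In the tetrahedron `x ≤ y+z`, `y ≤ x+z`, `z ≤ x+y` the corner `0`
is at squared distance `< 2` from every point with `x + y + z < 2`. -/
theorem tetra_near_origin (x y z : ℝ) (h1 : x ≤ y + z) (h2 : y ≤ x + z) (h3 : z ≤ x + y)
    (h4 : x + y + z < 2) : x ^ 2 + y ^ 2 + z ^ 2 < 2 := by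
  have hx : 0 ≤ x := by linarith
  have hy : 0 ≤ y := by linarith
  have hz : 0 ≤ z := by linarith
  have e1 : x * x ≤ x * (y + z) := mul_le_mul_of_nonneg_left h1 hx
  have e2 : y * y ≤ y * (x + z) := mul_le_mul_of_nonneg_left h2 hy
  have e3 : z * z ≤ z * (x + y) := mul_le_mul_of_nonneg_left h3 hz
  have hs : 0 ≤ x + y + z := by linarith
  have hsq : (x + y + z) * (x + y + z) < 2 * 2 := by nlinarith
  nlinarith

/-- **A convex combination does not exceed all its terms** (four terms). -/
theorem exists_ge_of_convex4 (μ₀ μ₁ μ₂ μ₃ f₀ f₁ f₂ f₃ : ℝ) (h₀ : 0 ≤ μ₀) (h₁ : 0 ≤ μ₁)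
    (h₂ : 0 ≤ μ₂) (h₃ : 0 ≤ μ₃) (hs : μ₀ + μ₁ + μ₂ + μ₃ = 1) :
    μ₀ * f₀ + μ₁ * f₁ + μ₂ * f₂ + μ₃ * f₃ ≤ f₀ ∨ μ₀ * f₀ + μ₁ * f₁ + μ₂ * f₂ + μ₃ * f₃ ≤ f₁ ∨
      μ₀ * f₀ + μ₁ * f₁ + μ₂ * f₂ + μ₃ * f₃ ≤ f₂ ∨ μ₀ * f₀ + μ₁ * f₁ + μ₂ * f₂ + μ₃ * f₃ ≤ f₃ := by
  -- generalise the value of the combination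
  suffices key : ∀ L : ℝ, μ₀ * f₀ + μ₁ * f₁ + μ₂ * f₂ + μ₃ * f₃ = L →
      L ≤ f₀ ∨ L ≤ f₁ ∨ L ≤ f₂ ∨ L ≤ f₃ from key _ rfl
  intro L hL
  by_contra h
  push Not at h
  obtain ⟨a₀, a₁, a₂, a₃⟩ := h
  have b₀ : μ₀ * f₀ ≤ μ₀ * L := mul_le_mul_of_nonneg_left a₀.le h₀
  have b₁ : μ₁ * f₁ ≤ μ₁ * L := mul_le_mul_of_nonneg_left a₁.le h₁
  have b₂ : μ₂ * f₂ ≤ μ₂ * L := mul_le_mul_of_nonneg_left a₂.le h₂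
  have b₃ : μ₃ * f₃ ≤ μ₃ * L := mul_le_mul_of_nonneg_left a₃.le h₃
  have e : μ₀ * L + μ₁ * L + μ₂ * L + μ₃ * L = L := by
    calc μ₀ * L + μ₁ * L + μ₂ * L + μ₃ * L = (μ₀ + μ₁ + μ₂ + μ₃) * L := by ring
      _ = L := by rw [hs, one_mul]
  -- some weight is positive and gives a strict inequality
  rcases lt_or_eq_of_le h₀ with p₀ | p₀
  · have := mul_lt_mul_of_pos_left a₀ p₀; linarith
  rcases lt_or_eq_of_le h₁ with p₁ | p₁
  · have := mul_lt_mul_of_pos_left a₁ p₁; linarith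
  rcases lt_or_eq_of_le h₂ with p₂ | p₂
  · have := mul_lt_mul_of_pos_left a₂ p₂; linarith
  rcases lt_or_eq_of_le h₃ with p₃ | p₃
  · have := mul_lt_mul_of_pos_left a₃ p₃; linarith
  linarith

/-! ## The unit cube -/

/-- **The tetrahedron** `conv{000, 110, 101, 011}` (strict version used by the case split). -/
theorem tetra_exists_near_ge (x y z l₁ l₂ l₃ : ℝ) (h1 : x < y + z) (h2 : y < x + z)
    (h3 : z < x + y) (h4 : x + y + z < 2) :
    ∃ a b c : ℤ, Even (a + b + c) ∧ (x - a) ^ 2 + (y - b) ^ 2 + (z - c) ^ 2 < 2 ∧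
      l₁ * x + l₂ * y + l₃ * z ≤ l₁ * a + l₂ * b + l₃ * c := by
  -- barycentric weights
  have := exists_ge_of_convex4 (1 - (x + y + z) / 2) ((x + y - z) / 2) ((x - y + z) / 2)
    ((-x + y + z) / 2) 0 (l₁ + l₂) (l₁ + l₃) (l₂ + l₃) (by linarith) (by linarith) (by linarith)
    (by linarith) (by ring)
  have hval : (1 - (x + y + z) / 2) * 0 + (x + y - z) / 2 * (l₁ + l₂) +
      (x - y + z) / 2 * (l₁ + l₃) + (-x + y + z) / 2 * (l₂ + l₃) = l₁ * x + l₂ * y + l₃ * z := by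
    ring
  rw [hval] at this
  rcases this with h | h | h | h
  · refine ⟨0, 0, 0, by decide, ?_, by push_cast; linarith⟩
    push_cast
    have := tetra_near_origin x y z h1.le h2.le h3.le h4
    nlinarith
  · refine ⟨1, 1, 0, by decide, ?_, by push_cast; linarith⟩
    push_cast
    have := tetra_near_origin (1 - x) (1 - y) z (by linarith) (by linarith) (by linarith)
      (by linarith)
    nlinarith
  · refine ⟨1, 0, 1, by decide, ?_, by push_cast; linarith⟩
    push_cast
    have := tetra_near_origin (1 - x) y (1 - z) (by linarith) (by linarith) (by linarith)
      (by linarith)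
    nlinarith
  · refine ⟨0, 1, 1, by decide, ?_, by push_cast; linarith⟩
    push_cast
    have := tetra_near_origin x (1 - y) (1 - z) (by linarith) (by linarith) (by linarith)
      (by linarith)
    nlinarith

/-- **The octant at the odd corner `100`** of the unit cube: `y + z ≤ x ≤ 1`, `y, z ≥ 0`. -/
theorem octant100_exists_near_ge (x y z l₁ l₂ l₃ : ℝ) (hx : x ≤ 1) (hy : 0 ≤ y) (hz : 0 ≤ z)
    (hoct : y + z ≤ x)
    (hD : ∀ a b c : ℤ, Even (a + b + c) → ¬((a : ℝ) = x ∧ (b : ℝ) = y ∧ (c : ℝ) = z)) :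
    ∃ a b c : ℤ, Even (a + b + c) ∧ (x - a) ^ 2 + (y - b) ^ 2 + (z - c) ^ 2 < 2 ∧
      l₁ * x + l₂ * y + l₃ * z ≤ l₁ * a + l₂ * b + l₃ * c := by
  -- local coordinates about the centre `c = (1,0,0)`: `t = (1 - x, y, z)`, `g = (-l₁, l₂, l₃)`
  have hS := octant_sq_lt_one (1 - x) y z (by linarith) hy hz (by linarith)
    (fun h => hD 0 0 0 (by decide) ⟨by push_cast; linarith, by push_cast; linarith,
      by push_cast; linarith⟩)
    (fun h => hD 1 1 0 (by decide) ⟨by push_cast; linarith, by push_cast; linarith,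
      by push_cast; linarith⟩)
    (fun h => hD 1 0 1 (by decide) ⟨by push_cast; linarith, by push_cast; linarith,
      by push_cast; linarith⟩)
  rcases octant_core (1 - x) y z (-l₁) l₂ l₃ (by linarith) hy hz (by linarith) hS with
    ⟨hd, hl⟩ | ⟨hd, hl⟩ | ⟨hd, hl⟩ | ⟨hd, hl⟩ | ⟨hd, hl⟩ | ⟨hd, hl⟩
  · exact ⟨0, 0, 0, by decide, by push_cast; nlinarith, by push_cast; linarith⟩
  · exact ⟨1, 1, 0, by decide, by push_cast; nlinarith, by push_cast; linarith⟩
  · exact ⟨1, 0, 1, by decide, by push_cast; nlinarith, by push_cast; linarith⟩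
  · exact ⟨2, 0, 0, by decide, by push_cast; nlinarith, by push_cast; linarith⟩
  · exact ⟨1, (-1), 0, by decide, by push_cast; nlinarith, by push_cast; linarith⟩
  · exact ⟨1, 0, (-1), by decide, by push_cast; nlinarith, by push_cast; linarith⟩

/-- **The octant at the odd corner `010`**: `x + z ≤ y ≤ 1`, `x, z ≥ 0`. -/
theorem octant010_exists_near_ge (x y z l₁ l₂ l₃ : ℝ) (hy : y ≤ 1) (hx : 0 ≤ x) (hz : 0 ≤ z)
    (hoct : x + z ≤ y)
    (hD : ∀ a b c : ℤ, Even (a + b + c) → ¬((a : ℝ) = x ∧ (b : ℝ) = y ∧ (c : ℝ) = z)) :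
    ∃ a b c : ℤ, Even (a + b + c) ∧ (x - a) ^ 2 + (y - b) ^ 2 + (z - c) ^ 2 < 2 ∧
      l₁ * x + l₂ * y + l₃ * z ≤ l₁ * a + l₂ * b + l₃ * c := by
  have hS := octant_sq_lt_one x (1 - y) z hx (by linarith) hz (by linarith)
    (fun h => hD 1 1 0 (by decide) ⟨by push_cast; linarith, by push_cast; linarith,
      by push_cast; linarith⟩)
    (fun h => hD 0 0 0 (by decide) ⟨by push_cast; linarith, by push_cast; linarith,
      by push_cast; linarith⟩)
    (fun h => hD 0 1 1 (by decide) ⟨by push_cast; linarith, by push_cast; linarith,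
      by push_cast; linarith⟩)
  rcases octant_core x (1 - y) z l₁ (-l₂) l₃ hx (by linarith) hz (by linarith) hS with
    ⟨hd, hl⟩ | ⟨hd, hl⟩ | ⟨hd, hl⟩ | ⟨hd, hl⟩ | ⟨hd, hl⟩ | ⟨hd, hl⟩
  · exact ⟨1, 1, 0, by decide, by push_cast; nlinarith, by push_cast; linarith⟩
  · exact ⟨0, 0, 0, by decide, by push_cast; nlinarith, by push_cast; linarith⟩
  · exact ⟨0, 1, 1, by decide, by push_cast; nlinarith, by push_cast; linarith⟩
  · exact ⟨(-1), 1, 0, by decide, by push_cast; nlinarith, by push_cast; linarith⟩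
  · exact ⟨0, 2, 0, by decide, by push_cast; nlinarith, by push_cast; linarith⟩
  · exact ⟨0, 1, (-1), by decide, by push_cast; nlinarith, by push_cast; linarith⟩

/-- **The octant at the odd corner `001`**: `x + y ≤ z ≤ 1`, `x, y ≥ 0`. -/
theorem octant001_exists_near_ge (x y z l₁ l₂ l₃ : ℝ) (hz : z ≤ 1) (hx : 0 ≤ x) (hy : 0 ≤ y)
    (hoct : x + y ≤ z)
    (hD : ∀ a b c : ℤ, Even (a + b + c) → ¬((a : ℝ) = x ∧ (b : ℝ) = y ∧ (c : ℝ) = z)) :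
    ∃ a b c : ℤ, Even (a + b + c) ∧ (x - a) ^ 2 + (y - b) ^ 2 + (z - c) ^ 2 < 2 ∧
      l₁ * x + l₂ * y + l₃ * z ≤ l₁ * a + l₂ * b + l₃ * c := by
  have hS := octant_sq_lt_one x y (1 - z) hx hy (by linarith) (by linarith)
    (fun h => hD 1 0 1 (by decide) ⟨by push_cast; linarith, by push_cast; linarith,
      by push_cast; linarith⟩)
    (fun h => hD 0 1 1 (by decide) ⟨by push_cast; linarith, by push_cast; linarith,
      by push_cast; linarith⟩)
    (fun h => hD 0 0 0 (by decide) ⟨by push_cast; linarith, by push_cast; linarith,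
      by push_cast; linarith⟩)
  rcases octant_core x y (1 - z) l₁ l₂ (-l₃) hx hy (by linarith) (by linarith) hS with
    ⟨hd, hl⟩ | ⟨hd, hl⟩ | ⟨hd, hl⟩ | ⟨hd, hl⟩ | ⟨hd, hl⟩ | ⟨hd, hl⟩
  · exact ⟨1, 0, 1, by decide, by push_cast; nlinarith, by push_cast; linarith⟩
  · exact ⟨0, 1, 1, by decide, by push_cast; nlinarith, by push_cast; linarith⟩
  · exact ⟨0, 0, 0, by decide, by push_cast; nlinarith, by push_cast; linarith⟩
  · exact ⟨(-1), 0, 1, by decide, by push_cast; nlinarith, by push_cast; linarith⟩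
  · exact ⟨0, (-1), 1, by decide, by push_cast; nlinarith, by push_cast; linarith⟩
  · exact ⟨0, 0, 2, by decide, by push_cast; nlinarith, by push_cast; linarith⟩

/-- **The octant at the odd corner `111`**: `x + y + z ≥ 2`, `x, y, z ≤ 1`. -/
theorem octant111_exists_near_ge (x y z l₁ l₂ l₃ : ℝ) (hx : x ≤ 1) (hy : y ≤ 1) (hz : z ≤ 1)
    (hoct : 2 ≤ x + y + z)
    (hD : ∀ a b c : ℤ, Even (a + b + c) → ¬((a : ℝ) = x ∧ (b : ℝ) = y ∧ (c : ℝ) = z)) :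
    ∃ a b c : ℤ, Even (a + b + c) ∧ (x - a) ^ 2 + (y - b) ^ 2 + (z - c) ^ 2 < 2 ∧
      l₁ * x + l₂ * y + l₃ * z ≤ l₁ * a + l₂ * b + l₃ * c := by
  have hS := octant_sq_lt_one (1 - x) (1 - y) (1 - z) (by linarith) (by linarith) (by linarith)
    (by linarith)
    (fun h => hD 0 1 1 (by decide) ⟨by push_cast; linarith, by push_cast; linarith,
      by push_cast; linarith⟩)
    (fun h => hD 1 0 1 (by decide) ⟨by push_cast; linarith, by push_cast; linarith,
      by push_cast; linarith⟩)
    (fun h => hD 1 1 0 (by decide) ⟨by push_cast; linarith, by push_cast; linarith,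
      by push_cast; linarith⟩)
  rcases octant_core (1 - x) (1 - y) (1 - z) (-l₁) (-l₂) (-l₃) (by linarith) (by linarith)
    (by linarith) (by linarith) hS with
    ⟨hd, hl⟩ | ⟨hd, hl⟩ | ⟨hd, hl⟩ | ⟨hd, hl⟩ | ⟨hd, hl⟩ | ⟨hd, hl⟩
  · exact ⟨0, 1, 1, by decide, by push_cast; nlinarith, by push_cast; linarith⟩
  · exact ⟨1, 0, 1, by decide, by push_cast; nlinarith, by push_cast; linarith⟩
  · exact ⟨1, 1, 0, by decide, by push_cast; nlinarith, by push_cast; linarith⟩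
  · exact ⟨2, 1, 1, by decide, by push_cast; nlinarith, by push_cast; linarith⟩
  · exact ⟨1, 2, 1, by decide, by push_cast; nlinarith, by push_cast; linarith⟩
  · exact ⟨1, 1, 2, by decide, by push_cast; nlinarith, by push_cast; linarith⟩

/-- **The unit cube with even corners `000, 110, 101, 011`.** -/
theorem cube_exists_near_ge (x y z l₁ l₂ l₃ : ℝ) (hx0 : 0 ≤ x) (hx1 : x ≤ 1) (hy0 : 0 ≤ y)
    (hy1 : y ≤ 1) (hz0 : 0 ≤ z) (hz1 : z ≤ 1)
    (hD : ∀ a b c : ℤ, Even (a + b + c) → ¬((a : ℝ) = x ∧ (b : ℝ) = y ∧ (c : ℝ) = z)) :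
    ∃ a b c : ℤ, Even (a + b + c) ∧ (x - a) ^ 2 + (y - b) ^ 2 + (z - c) ^ 2 < 2 ∧
      l₁ * x + l₂ * y + l₃ * z ≤ l₁ * a + l₂ * b + l₃ * c := by
  by_cases h1 : y + z ≤ x
  · exact octant100_exists_near_ge x y z l₁ l₂ l₃ hx1 hy0 hz0 h1 hD
  by_cases h2 : x + z ≤ y
  · exact octant010_exists_near_ge x y z l₁ l₂ l₃ hy1 hx0 hz0 h2 hD
  by_cases h3 : x + y ≤ z
  · exact octant001_exists_near_ge x y z l₁ l₂ l₃ hz1 hx0 hy0 h3 hD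
  by_cases h4 : 2 ≤ x + y + z
  · exact octant111_exists_near_ge x y z l₁ l₂ l₃ hx1 hy1 hz1 h4 hD
  push Not at h1 h2 h3 h4
  exact tetra_exists_near_ge x y z l₁ l₂ l₃ h1 h2 h3 h4

/-! ## All of `ℝ³` -/

/-- **Upper-neighbour lemma for `D₃`.**  For every `(x,y,z) ∉ D₃` and every linear functional
`(l₁,l₂,l₃)` there is `(a,b,c) ∈ D₃` with `(x−a)² + (y−b)² + (z−c)² < 2` and
`l₁x + l₂y + l₃z ≤ l₁a + l₂b + l₃c`. -/
theorem D3_exists_near_ge (x y z l₁ l₂ l₃ : ℝ)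
    (hD : ∀ a b c : ℤ, Even (a + b + c) → ¬((a : ℝ) = x ∧ (b : ℝ) = y ∧ (c : ℝ) = z)) :
    ∃ a b c : ℤ, Even (a + b + c) ∧ (x - a) ^ 2 + (y - b) ^ 2 + (z - c) ^ 2 < 2 ∧
      l₁ * x + l₂ * y + l₃ * z ≤ l₁ * a + l₂ * b + l₃ * c := by
  -- integer parts
  set n₁ := ⌊x⌋ with hn₁
  set n₂ := ⌊y⌋ with hn₂
  set n₃ := ⌊z⌋ with hn₃
  have fx := Int.floor_le x; have fx' := Int.lt_floor_add_one x
  have fy := Int.floor_le y; have fy' := Int.lt_floor_add_one y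
  have fz := Int.floor_le z; have fz' := Int.lt_floor_add_one z
  rcases Int.even_or_odd (n₁ + n₂ + n₃) with hev | hodd
  · -- translate by `-(n₁,n₂,n₃) ∈ D₃`
    have hD' : ∀ a b c : ℤ, Even (a + b + c) →
        ¬((a : ℝ) = x - n₁ ∧ (b : ℝ) = y - n₂ ∧ (c : ℝ) = z - n₃) := by
      intro a b c he h
      refine hD (a + n₁) (b + n₂) (c + n₃) ?_ ⟨?_, ?_, ?_⟩
      · have : a + n₁ + (b + n₂) + (c + n₃) = (a + b + c) + (n₁ + n₂ + n₃) := by ring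
        rw [this]; exact he.add hev
      · push_cast; linarith [h.1]
      · push_cast; linarith [h.2.1]
      · push_cast; linarith [h.2.2]
    obtain ⟨a, b, c, he, hd, hl⟩ := cube_exists_near_ge (x - n₁) (y - n₂) (z - n₃) l₁ l₂ l₃
      (by linarith) (by linarith) (by linarith) (by linarith) (by linarith) (by linarith) hD'
    refine ⟨a + n₁, b + n₂, c + n₃, ?_, ?_, ?_⟩
    · have : a + n₁ + (b + n₂) + (c + n₃) = (a + b + c) + (n₁ + n₂ + n₃) := by ring
      rw [this]; exact he.add hev
    · push_cast
      have e : (x - ((a:ℝ) + n₁)) ^ 2 + (y - ((b:ℝ) + n₂)) ^ 2 + (z - ((c:ℝ) + n₃)) ^ 2 =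
          (x - n₁ - a) ^ 2 + (y - n₂ - b) ^ 2 + (z - n₃ - c) ^ 2 := by ring
      rw [e]; exact hd
    · push_cast; linarith
  · -- translate by `-(n₁ - 1, n₂, n₃) ∈ D₃` and reflect the first coordinate about `1`
    obtain ⟨m, hm⟩ := hodd
    have hD' : ∀ a b c : ℤ, Even (a + b + c) →
        ¬((a : ℝ) = n₁ + 1 - x ∧ (b : ℝ) = y - n₂ ∧ (c : ℝ) = z - n₃) := by
      intro a b c he h
      refine hD (n₁ + 1 - a) (b + n₂) (c + n₃) ?_ ⟨?_, ?_, ?_⟩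
      · obtain ⟨r, hr⟩ := he
        exact ⟨m + 1 + r - a, by omega⟩
      · push_cast; linarith [h.1]
      · push_cast; linarith [h.2.1]
      · push_cast; linarith [h.2.2]
    obtain ⟨a, b, c, he, hd, hl⟩ := cube_exists_near_ge (n₁ + 1 - x) (y - n₂) (z - n₃)
      (-l₁) l₂ l₃
      (by linarith) (by linarith) (by linarith) (by linarith) (by linarith) (by linarith) hD'
    refine ⟨n₁ + 1 - a, b + n₂, c + n₃, ?_, ?_, ?_⟩
    · obtain ⟨r, hr⟩ := he
      exact ⟨m + 1 + r - a, by omega⟩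
    · push_cast
      have e : (x - ((n₁:ℝ) + 1 - a)) ^ 2 + (y - ((b:ℝ) + n₂)) ^ 2 + (z - ((c:ℝ) + n₃)) ^ 2 =
          (n₁ + 1 - x - a) ^ 2 + (y - n₂ - b) ^ 2 + (z - n₃ - c) ^ 2 := by ring
      rw [e]; exact hd
    · push_cast; linarith

end Summit.Ventures.Crystal3D.Theorems
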